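import Summits.Ventures.PercRepro2.CaseOnePocket

/-!
# Connections in the contracted graph of a pocket
(blind cell PercRepro2, p1 g27; the graph-side half of the pocket reduction)

For a pocket `(W, x, P)` (`IsPocket`), `a₃ ∈ W` and `e₀ ∈ P`, the contracted graph
`pocketEnds ends P e₀ a₃ x` with the contracted configuration `pocketCfg ends P e₀ a₃ x ω` has the same
connections as `(ends, ω)` among the vertices outside `W` (`conn_pocket_iff`) and between `a₃` and the
outside (`conn_pocket_a3_iff`): a path between outside vertices enters `W` only at `x` and leaves it only
at `x`, so it can be shortcut; a path from `a₃` to the outside leaves `W` at `x` after a segment inside `W`,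
which uses the edges of `P` only — exactly the event that opens the leaf edge `e₀`. Every proof is the
closure lemma `mem_of_conn_of_closed` of `Graph.lean` with an explicit closed vertex set, as in
`conn_series_iff`. `connEvent_pocket` states the correspondence for the events among the preserved
vertices `Wᶜ ∪ {a₃}` (with `a₃` anywhere: outside `W` the edge `e₀` is a null edge between outside
vertices). Own code; standard axioms. -/

namespace Summit.Ventures.PercRepro2

namespace CaseOne

/-! ## Connections in the contracted graph -/

section PocketConn
variable {V : Type*} {E : Type*} [DecidableEq E] {ends : E → Sym2 V} {W : Set V} {x : V}
  {P : Finset E} {e₀ : E} {a₃ : V} (ω : Config E)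

/-- Connections in the contracted graph are connections in `G`. -/
lemma conn_of_conn_pocket {u v : V}
    (huv : Conn (pocketEnds ends P e₀ a₃ x) (pocketCfg ends P e₀ a₃ x ω) u v) : Conn ends ω u v := by
  let S : Set V := {y | Conn ends ω u y}
  have hS : ∀ y ∈ S, ∀ z,
      (openGraph (pocketEnds ends P e₀ a₃ x) (pocketCfg ends P e₀ a₃ x ω)).Adj y z → z ∈ S := by
    intro y hy z hadj
    rw [openGraph_adj] at hadj
    obtain ⟨-, e, hopen, hends⟩ := hadj
    by_cases h0 : e = e₀
    · rw [h0] at hopen hends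
      have hc : Conn ends ω a₃ x :=
        conn_mono (inOnly_le P ω) ((pocketCfg_self e₀ a₃ x ω).1 hopen)
      rw [pocketEnds_self, Sym2.eq_iff] at hends
      rcases hends with ⟨rfl, rfl⟩ | ⟨rfl, rfl⟩
      · exact conn_trans hy (conn_symm hc)
      · exact conn_trans hy hc
    · by_cases heP : e ∈ P
      · rw [pocketCfg_of_mem h0 heP] at hopen
        exact absurd hopen Bool.false_ne_true
      · rw [pocketCfg_of_not_mem h0 heP] at hopen
        rw [pocketEnds_of_not_mem h0 heP] at hends
        exact conn_trans hy (conn_of_openAdj ⟨e, hopen, hends⟩)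
  exact mem_of_conn_of_closed hS (conn_refl ends ω u) huv

omit [DecidableEq E] in
/-- An edge of `G` between two vertices outside `W` is not in `P`. -/
lemma IsPocket.not_mem_P_of_ends (h : IsPocket ends W x P) {e : E} {y z : V} (hends : ends e = s(y, z))
    (hy : y ∉ W) (hz : z ∉ W) : e ∉ P := by
  intro heP
  obtain ⟨y', hy'W, hy'e⟩ := (h.mem_iff e).1 heP
  rw [hends, Sym2.mem_iff] at hy'e
  rcases hy'e with rfl | rfl
  · exact hy hy'W
  · exact hz hy'W

/-- An open edge of `G` between vertices outside `W` is an open edge of the contracted graph. -/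
lemma conn_pocket_of_openAdj (h : IsPocket ends W x P) (he : e₀ ∈ P) {e : E} {y z : V}
    (hopen : ω e = true) (hends : ends e = s(y, z)) (hy : y ∉ W) (hz : z ∉ W) :
    Conn (pocketEnds ends P e₀ a₃ x) (pocketCfg ends P e₀ a₃ x ω) y z := by
  have heP : e ∉ P := h.not_mem_P_of_ends hends hy hz
  have hne : e ≠ e₀ := fun h' => heP (h' ▸ he)
  refine conn_of_openAdj ⟨e, ?_, ?_⟩
  · rw [pocketCfg_of_not_mem hne heP]
    exact hopen
  · rw [pocketEnds_of_not_mem hne heP]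
    exact hends

/-- A connection in `G` between vertices outside `W` is a connection in the contracted graph. -/
lemma conn_pocket_of_conn (h : IsPocket ends W x P) (he : e₀ ∈ P) {u v : V} (hu : u ∉ W) (hv : v ∉ W)
    (huv : Conn ends ω u v) :
    Conn (pocketEnds ends P e₀ a₃ x) (pocketCfg ends P e₀ a₃ x ω) u v := by
  let S : Set V := {y | (y ∉ W ∧ Conn (pocketEnds ends P e₀ a₃ x) (pocketCfg ends P e₀ a₃ x ω) u y) ∨
    (y ∈ W ∧ Conn (pocketEnds ends P e₀ a₃ x) (pocketCfg ends P e₀ a₃ x ω) u x)}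
  have hS : ∀ y ∈ S, ∀ z, (openGraph ends ω).Adj y z → z ∈ S := by
    intro y hy z hadj
    rw [openGraph_adj] at hadj
    obtain ⟨-, e, hopen, hends⟩ := hadj
    have hye : y ∈ ends e := by rw [hends]; exact Sym2.mem_mk_left y z
    have hze : z ∈ ends e := by rw [hends]; exact Sym2.mem_mk_right y z
    rcases hy with ⟨hyW, hcy⟩ | ⟨hyW, hcx⟩
    · by_cases hzW : z ∈ W
      · -- entering `W` through `x`
        have heP : e ∈ P := h.mem_P hzW hze
        have hyx : y = x := h.eq_x heP hye hyW
        exact Or.inr ⟨hzW, hyx ▸ hcy⟩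
      · -- an outside edge is an edge of the contracted graph
        exact Or.inl ⟨hzW, conn_trans hcy (conn_pocket_of_openAdj ω h he hopen hends hyW hzW)⟩
    · -- inside `W`: the edge stays in `W ∪ {x}`
      have heP : e ∈ P := h.mem_P hyW hye
      rcases h.ends_mem e heP z hze with hzW | hzx
      · exact Or.inr ⟨hzW, hcx⟩
      · exact Or.inl ⟨hzx ▸ h.x_not_mem, hzx ▸ hcx⟩
  have hvS : v ∈ S := mem_of_conn_of_closed hS (Or.inl ⟨hu, conn_refl _ _ u⟩) huv
  rcases hvS with ⟨-, hcv⟩ | ⟨hvW, -⟩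
  · exact hcv
  · exact absurd hvW hv

/-- In the contracted graph every open edge at `a₃` is `e₀`: a connection of `a₃` to another vertex
opens `e₀`. -/
lemma pocketCfg_self_of_conn (h : IsPocket ends W x P) (ha : a₃ ∈ W) {v : V} (hv : v ≠ a₃)
    (hc : Conn (pocketEnds ends P e₀ a₃ x) (pocketCfg ends P e₀ a₃ x ω) a₃ v) :
    pocketCfg ends P e₀ a₃ x ω e₀ = true := by
  let S : Set V := {y | y = a₃ ∨ pocketCfg ends P e₀ a₃ x ω e₀ = true}
  have hS : ∀ y ∈ S, ∀ z,
      (openGraph (pocketEnds ends P e₀ a₃ x) (pocketCfg ends P e₀ a₃ x ω)).Adj y z → z ∈ S := by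
    intro y hy z hadj
    rcases hy with rfl | hy
    · rw [openGraph_adj] at hadj
      obtain ⟨-, e, hopen, hends⟩ := hadj
      by_cases h0 : e = e₀
      · rw [h0] at hopen
        exact Or.inr hopen
      · by_cases heP : e ∈ P
        · rw [pocketCfg_of_mem h0 heP] at hopen
          exact absurd hopen Bool.false_ne_true
        · rw [pocketEnds_of_not_mem h0 heP] at hends
          exact absurd (h.mem_P ha (by rw [hends]; exact Sym2.mem_mk_left y z)) heP
    · exact Or.inr hy
  have hvS : v ∈ S := mem_of_conn_of_closed hS (Or.inl rfl) hc
  rcases hvS with hva | hv'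
  · exact absurd hva hv
  · exact hv'

/-- A connection of `a₃` to a vertex outside `W` in `G` is a connection in the contracted graph. -/
lemma conn_pocket_a3_of_conn (h : IsPocket ends W x P) (he : e₀ ∈ P) (ha : a₃ ∈ W) {v : V}
    (hv : v ∉ W) (hc : Conn ends ω a₃ v) :
    Conn (pocketEnds ends P e₀ a₃ x) (pocketCfg ends P e₀ a₃ x ω) a₃ v := by
  let S : Set V := {y | (y ∈ W ∧ Conn ends (inOnly P ω) a₃ y) ∨
    (y ∉ W ∧ Conn (pocketEnds ends P e₀ a₃ x) (pocketCfg ends P e₀ a₃ x ω) a₃ y)}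
  have hax : a₃ ≠ x := fun h' => h.x_not_mem (h' ▸ ha)
  -- a connection `a₃ ↔ x` through `P` is the open leaf edge
  have hleaf : Conn ends (inOnly P ω) a₃ x →
      Conn (pocketEnds ends P e₀ a₃ x) (pocketCfg ends P e₀ a₃ x ω) a₃ x := fun hc' =>
    conn_of_openAdj ⟨e₀, (pocketCfg_self e₀ a₃ x ω).2 hc', by rw [pocketEnds_self, Sym2.eq_swap]⟩
  have hS : ∀ y ∈ S, ∀ z, (openGraph ends ω).Adj y z → z ∈ S := by
    intro y hy z hadj
    rw [openGraph_adj] at hadj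
    obtain ⟨-, e, hopen, hends⟩ := hadj
    have hye : y ∈ ends e := by rw [hends]; exact Sym2.mem_mk_left y z
    have hze : z ∈ ends e := by rw [hends]; exact Sym2.mem_mk_right y z
    rcases hy with ⟨hyW, hcy⟩ | ⟨hyW, hcy⟩
    · -- inside `W`: the edge is in `P`, open in the `P`-part
      have heP : e ∈ P := h.mem_P hyW hye
      have hopen' : inOnly P ω e = true := by simp [heP, hopen]
      have hcz : Conn ends (inOnly P ω) a₃ z := conn_trans hcy (conn_of_openAdj ⟨e, hopen', hends⟩)
      rcases h.ends_mem e heP z hze with hzW | hzx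
      · exact Or.inl ⟨hzW, hcz⟩
      · exact Or.inr ⟨hzx ▸ h.x_not_mem, hzx ▸ hleaf (hzx ▸ hcz)⟩
    · by_cases hzW : z ∈ W
      · -- re-entering `W` through `x`: the leaf edge is open, the edge is in `P`
        have heP : e ∈ P := h.mem_P hzW hze
        have hyx : y = x := h.eq_x heP hye hyW
        have hopen₀ : pocketCfg ends P e₀ a₃ x ω e₀ = true :=
          pocketCfg_self_of_conn ω h ha (hyx ▸ hax.symm) hcy
        have hcx : Conn ends (inOnly P ω) a₃ x := (pocketCfg_self e₀ a₃ x ω).1 hopen₀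
        have hopen' : inOnly P ω e = true := by simp [heP, hopen]
        exact Or.inl ⟨hzW, conn_trans (hyx ▸ hcx) (conn_of_openAdj ⟨e, hopen', hends⟩)⟩
      · exact Or.inr ⟨hzW, conn_trans hcy (conn_pocket_of_openAdj ω h he hopen hends hyW hzW)⟩
  have hvS : v ∈ S := mem_of_conn_of_closed hS (Or.inl ⟨ha, conn_refl _ _ a₃⟩) hc
  rcases hvS with ⟨hvW, -⟩ | ⟨-, hcv⟩
  · exact absurd hvW hv
  · exact hcv

/-- **Connections among vertices outside `W` are the same in `G` and in the contracted graph.** -/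
theorem conn_pocket_iff (h : IsPocket ends W x P) (he : e₀ ∈ P) {u v : V} (hu : u ∉ W) (hv : v ∉ W) :
    Conn ends ω u v ↔ Conn (pocketEnds ends P e₀ a₃ x) (pocketCfg ends P e₀ a₃ x ω) u v :=
  ⟨conn_pocket_of_conn ω h he hu hv, conn_of_conn_pocket ω⟩

/-- **The connections of `a₃` to the outside are the same in `G` and in the contracted graph.** -/
theorem conn_pocket_a3_iff (h : IsPocket ends W x P) (he : e₀ ∈ P) (ha : a₃ ∈ W) {v : V}
    (hv : v ∉ W) :
    Conn ends ω a₃ v ↔ Conn (pocketEnds ends P e₀ a₃ x) (pocketCfg ends P e₀ a₃ x ω) a₃ v :=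
  ⟨conn_pocket_a3_of_conn ω h he ha hv, conn_of_conn_pocket ω⟩

/-- **The vertices whose connections the contraction preserves: outside `W`, or `a₃` itself** (`a₃`
anywhere: inside `W` it is the leaf of the contracted graph, outside `W` the edge `e₀` is a null edge
between outside vertices). -/
theorem conn_pocket_iff_of_outer (h : IsPocket ends W x P) (he : e₀ ∈ P) {u v : V}
    (hu : u ∉ W ∨ u = a₃) (hv : v ∉ W ∨ v = a₃) :
    Conn ends ω u v ↔ Conn (pocketEnds ends P e₀ a₃ x) (pocketCfg ends P e₀ a₃ x ω) u v := by
  by_cases ha : a₃ ∈ W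
  · rcases hu with hu | rfl
    · rcases hv with hv | rfl
      · exact conn_pocket_iff ω h he hu hv
      · exact ⟨fun h' => conn_symm ((conn_pocket_a3_iff ω h he ha hu).1 (conn_symm h')),
          fun h' => conn_symm ((conn_pocket_a3_iff ω h he ha hu).2 (conn_symm h'))⟩
    · rcases hv with hv | rfl
      · exact conn_pocket_a3_iff ω h he ha hv
      · exact ⟨fun _ => conn_refl _ _ _, fun _ => conn_refl _ _ _⟩
  · have hu' : u ∉ W := hu.elim id fun h' => h' ▸ ha
    have hv' : v ∉ W := hv.elim id fun h' => h' ▸ ha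
    exact conn_pocket_iff ω h he hu' hv'

/-- The connection event among preserved vertices is the preimage of the event in the contracted graph. -/
theorem connEvent_pocket (h : IsPocket ends W x P) (he : e₀ ∈ P) {u v : V}
    (hu : u ∉ W ∨ u = a₃) (hv : v ∉ W ∨ v = a₃) :
    connEvent ends u v = pocketCfg ends P e₀ a₃ x ⁻¹' connEvent (pocketEnds ends P e₀ a₃ x) u v := by
  ext ω
  simp only [mem_connEvent, Set.mem_preimage]
  exact conn_pocket_iff_of_outer ω h he hu hv

end PocketConn

end CaseOne

end Summit.Ventures.PercRepro2
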